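/-
Copyright: derived here (Resolution Observatory cell `pub-rosobs`, carver gen 57). AI-written Lean; AI review is weaker than expert
review.  The rational arithmetic of engine 1's boundary statements PROPOSITION B / THEOREM B′ (THEOREM-LT-eng1-g38 §9) at the sharp rate
`ρ₁ = 1/(p(p+1))` of the cell's POLYNOMIAL weighted-centre model `W(f)`.  Instrument — NOT a resolution theorem and NOT a statement about
the invariant of [AbramovichTemkinWlodarczyk2024].
-/
import Mathlib.Tactic.FieldSimp
import Mathlib.Tactic.Linarith
import Mathlib.Tactic.NormNum
import Mathlib.Tactic.Positivity
import Mathlib.Tactic.Ring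
import Mathlib.Algebra.Order.Field.Basic
import HarnessLib

/-!
# Boundary arithmetic at the sharp rate `ρ₁ = 1/(p(p+1))` (PROPOSITION B / THEOREM B′ of THEOREM-LT-eng1-g38 §9)

Uniform value line: INSTRUMENT — kernel-checked side conditions (pure `ℚ`-arithmetic) of engine 1's boundary statements for the cell's
polynomial weighted-centre model `W(f)`; NOT a resolution theorem, NOT a statement about the Abramovich–Temkin–Włodarczyk invariant, NOT
summit progress; AI-written Lean, AI review is weaker than expert review.  Companion of `WeightedCentreLTKit` §4 (the open window
`ρ > 1/(p(p+1))`); here the closed endpoint.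

Dictionary (THEOREM-LT §9, PROPOSITION B (1)–(3) and THEOREM B′): `p²ρ₁ = p/(p+1) > 1/2` (so `p^e ρ₁ ≤ 1/2`, `e ≥ 1` forces `e = 1`:
**`e_eq_one_at_boundary`**); `w* = pρ₁ = 1/(p+1)` (**`p_mul_rho1`**); the moving class `u = (p+1)ρ₁ = 1/p` (**`succ_mul_rho1`**) has image
weight `1/p − ρ₁ = 1/(p+1) = w_min` (**`inv_sub_rho1`**); a class `v < 1/p` has image weight `v − ρ₁ < 1/(p+1)`, i.e. below `w_min`, hence is
`D`-constant for free (**`sub_rho1_lt`**); a product of `≥ 2` slots weighs `≥ 2/(p+1) > 1/(p+1)`, so the images `T_f` on the class `1/p` are LINEAR forms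
in the class-`1/(p+1)` slots (**`two_min_gt_image`**; the monomial shape itself is the tree's `eq_single_or_forall_lt_of_weight_eq`, file
`WeightedCentreGradedAutomorphism`); pin degrees `d_h = (1 − wt h)/u = p(1 − wt h) < p` for `wt h > 0` and `= p` for `h = 1`
(**`pin_degree_lt`**, **`pin_degree_top`**); THEOREM B′'s hypothesis `q = p^e > p(p+1)` is `ρ₁ > η = 1/q` (**`rho1_gt_eta_iff`**).

References: [AbramovichTemkinWlodarczyk2024] §5 (weights of weighted centres; context only).  Statements ours, elementary.
-/

namespace Literature.AlgebraicGeometry.Resolution.WeightedBlowup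

namespace BoundaryArith

/-- `p² · ρ₁ = p/(p+1)`. [cite: AbramovichTemkinWlodarczyk2024, §5] -/
theorem sq_mul_rho1 {p : ℚ} (hp : 0 < p) : p ^ 2 * (1 / (p * (p + 1))) = p / (p + 1) := by
  field_simp

/-- `p/(p+1) > 1/2` for `p ≥ 2` (indeed for `p > 1`). [cite: AbramovichTemkinWlodarczyk2024, §5] -/
theorem half_lt_p_div_succ {p : ℚ} (hp : 1 < p) : 1 / 2 < p / (p + 1) := by
  rw [div_lt_div_iff₀ (by norm_num) (by linarith)]
  linarith

/-- At the boundary: `p ≥ 2`, `e ≥ 1`, `p^e ρ₁ ≤ 1/2` force `e = 1` (PROPOSITION B (1): `j* = p`, `w* = pρ₁`).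
[cite: AbramovichTemkinWlodarczyk2024, §5] -/
theorem e_eq_one_at_boundary {p e : ℕ} (hp : 2 ≤ p) (he : 1 ≤ e) (hw : (p : ℚ) ^ e * (1 / ((p : ℚ) * (p + 1))) ≤ 1 / 2) : e = 1 := by
  by_contra hne
  have he2 : 2 ≤ e := by omega
  have hp2 : (2 : ℚ) ≤ p := by exact_mod_cast hp
  have hpow : (p : ℚ) ^ 2 ≤ (p : ℚ) ^ e := pow_le_pow_right₀ (by linarith) he2
  have hpos : (0 : ℚ) < 1 / ((p : ℚ) * (p + 1)) := by positivity
  have h1 : (p : ℚ) ^ 2 * (1 / ((p : ℚ) * (p + 1))) ≤ 1 / 2 := le_trans (mul_le_mul_of_nonneg_right hpow hpos.le) hw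
  rw [sq_mul_rho1 (by linarith)] at h1
  have h2 := half_lt_p_div_succ (p := (p : ℚ)) (by linarith)
  linarith

/-- `w* = p · ρ₁ = 1/(p+1)`. [cite: AbramovichTemkinWlodarczyk2024, §5] -/
theorem p_mul_rho1 {p : ℚ} (hp : 0 < p) : p * (1 / (p * (p + 1))) = 1 / (p + 1) := by
  field_simp

/-- The moving class: `(p+1) · ρ₁ = 1/p`. [cite: AbramovichTemkinWlodarczyk2024, §5] -/
theorem succ_mul_rho1 {p : ℚ} (hp : 0 < p) : (p + 1) * (1 / (p * (p + 1))) = 1 / p := by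
  field_simp

/-- Image weight of the moving class: `1/p − ρ₁ = 1/(p+1)` (`= w_min`). [cite: AbramovichTemkinWlodarczyk2024, §5] -/
theorem inv_sub_rho1 {p : ℚ} (hp : 0 < p) : 1 / p - 1 / (p * (p + 1)) = 1 / (p + 1) := by
  field_simp
  ring

/-- A class `v < 1/p` has image weight `v − ρ₁ < 1/(p+1)` — below the least slot weight, so it is `D`-constant for free (PROPOSITION B (2)).
[cite: AbramovichTemkinWlodarczyk2024, §5] -/
theorem sub_rho1_lt {p v : ℚ} (hp : 0 < p) (hv : v < 1 / p) : v - 1 / (p * (p + 1)) < 1 / (p + 1) := by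
  have := inv_sub_rho1 hp
  linarith

/-- Products of `≥ 2` slots are too heavy for the image of the moving class: `k ≥ 2` slots of weight `≥ 1/(p+1)` weigh `≥ 2/(p+1) > 1/(p+1) = 1/p − ρ₁`
(PROPOSITION B (2): the images `T_f` are linear forms in the class-`1/(p+1)` slots). [cite: AbramovichTemkinWlodarczyk2024, §5] -/
theorem two_min_gt_image {p : ℚ} (hp : 0 < p) {k : ℕ} (hk : 2 ≤ k) {s : ℚ} (hs : (k : ℚ) * (1 / (p + 1)) ≤ s) :
    1 / p - 1 / (p * (p + 1)) < s := by
  rw [inv_sub_rho1 hp]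
  have hk2 : (2 : ℚ) ≤ k := by exact_mod_cast hk
  have hpos : (0 : ℚ) < 1 / (p + 1) := by positivity
  have : 2 * (1 / (p + 1)) ≤ s := le_trans (mul_le_mul_of_nonneg_right hk2 hpos.le) hs
  linarith

/-- Pin degrees on the moving class `u = 1/p`: `d_h = (1 − wt h)/u = p(1 − wt h) < p` for a heavy part of positive weight (PROPOSITION B (3), `h ≠ 1`).
[cite: AbramovichTemkinWlodarczyk2024, §5] -/
theorem pin_degree_lt {p t : ℚ} (hp : 0 < p) (ht : 0 < t) : (1 - t) / (1 / p) < p := by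
  rw [div_lt_iff₀ (by positivity), mul_one_div_cancel hp.ne']
  linarith

/-- … and `= p` for the empty heavy part `h = 1` (PROPOSITION B (3): the Frobenius pin `ε_{f₀}^p`). [cite: AbramovichTemkinWlodarczyk2024, §5] -/
theorem pin_degree_top (p : ℚ) : (1 - 0) / (1 / p) = p := by
  rw [sub_zero, one_div_one_div]

/-- THEOREM B′'s hypothesis `q = p^e > p(p+1)` is exactly `ρ₁ > η = 1/q`. [cite: AbramovichTemkinWlodarczyk2024, §5] -/
theorem rho1_gt_eta_iff {p : ℕ} (hp : 0 < p) (e : ℕ) :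
    (1 : ℚ) / (p : ℚ) ^ e < 1 / ((p : ℚ) * (p + 1)) ↔ p * (p + 1) < p ^ e := by
  have hp' : (0 : ℚ) < p := by exact_mod_cast hp
  rw [one_div_lt_one_div (by positivity) (by positivity)]
  norm_cast

end BoundaryArith

end Literature.AlgebraicGeometry.Resolution.WeightedBlowup
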